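/-
Copyright (c) 2026 the pub-hodgecm-mathlib formalisation cell (harness21).  Prover seat hodgecm-mathlib-K2E3-p21 (g7), HCML Track B «K2-LIT» ∕ h413
(`stmt-HodgeConjecture-24833`), line `K2_E3_EllipticInputs`, leaf (nsc-S-A′), brick (E4b) = discharge of `h3cell` of ★ E4a, part (E4b-1β) MIDDLE CELL (dealer D107), file 3a:
the UNIFORM SUPPORT RADIUS of the middle-cell integrand over integral points of `P_{(2,1)}` (architect K2E3-p25 (g2); consumer: the kernel file 3b).  2026-09-04.
-/
import Summits.HodgeConjecture.HodgeConjecture.Theorems.K2E3GL3BorelInducedJacquetQMiddleCellIntegrand   -- ★ file 1 (this seat, p860169): integrand, e-coordinates currency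
import Summits.HodgeConjecture.HodgeConjecture.Theorems.K2E3GL3BorelInducedJacquetQOpenCellSupport    -- ★ (E4b-1γ) part 1 (p25): `exists_transvections_fix`, `toFun_eq_zero_of_mul_mem`, `mul_transvectionUnit_two_*_apply`
import Literature.NumberTheory.Automorphic.HeckeTransversalGL                                        -- ★ `glInt`, `valuation_apply_le_one_of_mem_glInt`, `valuation_det_eq_one_of_mem_glInt`
import HarnessLib

/-!
# K2_E3 road (h413), leaf (nsc-S-A′), brick (E4b-1β) file 3a — UNIFORM SUPPORT OF THE MIDDLE-CELL INTEGRAND `y ↦ f(s₂·x₁₂(y)·k)` OVER INTEGRAL `k ∈ P_{(2,1)}`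

Cell `pub/hodgecm-mathlib` (D-0151), Track B, seat K2E3-p21 (g7).  `--supports stmt-HodgeConjecture-24833 --as helper`; THEOREMS ONLY; COUNT-NEUTRAL.

THE MATHEMATICS ([BernsteinZelevinsky1977, §5 (5.14), Thm. 5.2]; [Casselman1995, Prop. 6.3.1]).  The point `h = s₂ x₁₂(y) k` (`k ∈ P = P_{(2,1)}`) has bottom row
`(k₁₀, k₁₁, k₁₂ + y k₂₂)`.  For `f ∈ Ind_B σ′` vanishing on `P` and fixed by the lower root elements `t₂₀(α)`, `t₂₁(β)` with `|α|, |β| < ε` (★ `exists_transvections_fix`):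
right multiplication by `t₂₀(−k₁₀∕h₂₂) t₂₁(−k₁₁∕h₂₂)` moves `h` into `P`, so `f(h) = 0` as soon as `|k₁₀∕h₂₂|, |k₁₁∕h₂₂| < ε` (★ `toFun_eq_zero_of_mul_mem`).
For `k` with INTEGRAL entries and a UNIT `k₂₂` (every `k ∈ P ∩ GL₃(𝒪)`) and `|y| > max(1, ε⁻¹)`: `|h₂₂| = |y|` and the condition holds — **`toFun_swap_coordOneTwo_eq_zero_of_lt_valuation`**:
the integrand `y ↦ f(s₂ x₁₂(y) k)` is supported in the ball `|y| ≤ max(1, ε⁻¹)` UNIFORMLY over integral `k` (the uniformity that makes one compact open averaging subgroup of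
`U_P` work for all points of the middle cell, file 3b).
§1 entries of `h = s₂ x₁₂(y) k`; §2 the support lemma; §3 its integral-point form (`k ∈ P ∩ GL₃(𝒪)`).

HONEST LABEL: HC_CM is proved only modulo the 7 printed citations (2 remaining named inputs: hLiu418 = stmt-HodgeConjecture-24832, h413 = stmt-HodgeConjecture-24833) until
rung 0 closes; count-neutral helper.

## Mathlib ∕ tree search
★ `exists_transvections_fix`, `toFun_eq_zero_of_mul_mem`, `mul_transvectionUnit_two_zero_apply ∕ _two_one_apply` (1γ part 1) · ★ `coe_permGL`, `permMatrix_apply'`, `mem_standardParabolicGL_iff_entry` ·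
★ `valuation_apply_le_one_of_mem_glInt`, `valuation_det_eq_one_of_mem_glInt` · Mathlib `Valuation.map_add_eq_of_lt_left`, `Valuation.map_div`.  Dedup: `lean search 'swap_coordOneTwo_eq_zero'` — none.

## References
* [BernsteinZelevinsky1977] I. N. Bernstein, A. V. Zelevinsky, *Induced representations of reductive p-adic groups I*, Ann. Sci. ÉNS 10 (1977), §5 (5.14), Thm. 5.2.
* [Casselman1995] W. Casselman, *Introduction to the theory of admissible representations of p-adic reductive groups* (draft 1995), §6.3, Prop. 6.3.1.
-/

set_option autoImplicit false
set_option linter.dupNamespace false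

noncomputable section

open Set Function Representation
open scoped MatrixGroups

namespace Summit.HodgeConjecture.HodgeConjecture.Cruxes.H413.K2E3GL3BorelInducedJacquetQMiddleCellSupport

open Literature.NumberTheory.Automorphic ValuativeRel
open Literature.NumberTheory.GaloisRepresentations Literature.NumberTheory.GaloisRepresentations.IsNonarchimedeanLocalField
open Summit.HodgeConjecture.HodgeConjecture.Cruxes.H413.K2E3GL3BorelInducedJacquetQOpenCellSupport

variable {F : Type} [Field F]

/-! ## §1 The bottom row of `h = s₂ · x₁₂(y) · k` for `k ∈ P_{(2,1)}` -/

section Entries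

variable [TopologicalSpace F]
  (e : (F × F) × F ≃ₜ ↥(unipotentRadicalGL F (id : Fin 3 → Fin 3)))
  (he : ∀ p : (F × F) × F, (((e p : ↥(unipotentRadicalGL F (id : Fin 3 → Fin 3))) : GL (Fin 3) F) : Matrix (Fin 3) (Fin 3) F) = !![1, p.1.1, p.2; 0, 1, p.1.2; 0, 0, 1])
include he

/-- **The bottom row of `s₂ x₁₂(y) k`** is `(k₁₀, k₁₁, k₁₂ + y k₂₂)` for `k ∈ P_{(2,1)}` (`k₂₀ = k₂₁ = 0`); its `(1,2)` entry is `k₂₂`. [cite: BernsteinZelevinsky1977, Thm. 5.2] -/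
theorem swap_coordOneTwo_mul_apply {k : GL (Fin 3) F} (hk : k ∈ (standardParabolicGL F (![0, 0, 1] : Fin 3 → Fin 2))) (y : F) :
    (((permGL (Equiv.swap (1 : Fin 3) 2) : GL (Fin 3) F) * ((e ((0, y), 0) : ↥(unipotentRadicalGL F (id : Fin 3 → Fin 3))) : GL (Fin 3) F) * k : GL (Fin 3) F) : Matrix (Fin 3) (Fin 3) F) 2 0 = (k : Matrix (Fin 3) (Fin 3) F) 1 0 ∧
    (((permGL (Equiv.swap (1 : Fin 3) 2) : GL (Fin 3) F) * ((e ((0, y), 0) : ↥(unipotentRadicalGL F (id : Fin 3 → Fin 3))) : GL (Fin 3) F) * k : GL (Fin 3) F) : Matrix (Fin 3) (Fin 3) F) 2 1 = (k : Matrix (Fin 3) (Fin 3) F) 1 1 ∧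
    (((permGL (Equiv.swap (1 : Fin 3) 2) : GL (Fin 3) F) * ((e ((0, y), 0) : ↥(unipotentRadicalGL F (id : Fin 3 → Fin 3))) : GL (Fin 3) F) * k : GL (Fin 3) F) : Matrix (Fin 3) (Fin 3) F) 2 2 = (k : Matrix (Fin 3) (Fin 3) F) 1 2 + y * (k : Matrix (Fin 3) (Fin 3) F) 2 2 ∧
    (((permGL (Equiv.swap (1 : Fin 3) 2) : GL (Fin 3) F) * ((e ((0, y), 0) : ↥(unipotentRadicalGL F (id : Fin 3 → Fin 3))) : GL (Fin 3) F) * k : GL (Fin 3) F) : Matrix (Fin 3) (Fin 3) F) 1 2 = (k : Matrix (Fin 3) (Fin 3) F) 2 2 := by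
  obtain ⟨h20, h21⟩ := (K2E3GL3MaximalParabolicRelabel.mem_standardParabolicGL_iff_entry k).1 hk
  simp only [Units.val_mul, coe_permGL, he]
  refine ⟨?_, ?_, ?_, ?_⟩ <;>
    simp [Matrix.mul_apply, Fin.sum_univ_three, h20, h21]

end Entries

/-! ## §2 The support lemma: `f(s₂ x₁₂(y) k) = 0` once `|k₁₀|, |k₁₁| < ε · |k₁₂ + y k₂₂|` -/

section Support

variable [ValuativeRel F] [TopologicalSpace F] [IsNonarchimedeanLocalField F]
  (σ' : Representation ℂ ↥(standardParabolicGL F (id : Fin 3 → Fin 3)) ℂ)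
  (e : (F × F) × F ≃ₜ ↥(unipotentRadicalGL F (id : Fin 3 → Fin 3)))
  (he : ∀ p : (F × F) × F, (((e p : ↥(unipotentRadicalGL F (id : Fin 3 → Fin 3))) : GL (Fin 3) F) : Matrix (Fin 3) (Fin 3) F) = !![1, p.1.1, p.2; 0, 1, p.1.2; 0, 0, 1])
include he

/-- **THE MIDDLE-CELL SUPPORT LEMMA.**  `f ∈ Ind_B σ′` vanishing on `P_{(2,1)}` and fixed by `t₂₀(α)`, `t₂₁(β)` for `|α|, |β| < ε`; `k ∈ P_{(2,1)}`, `y ∈ F` with `h₂₂ := k₁₂ + y k₂₂ ≠ 0` and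
`|k₁₀|, |k₁₁| < ε |h₂₂|`.  Then `f(s₂ · x₁₂(y) · k) = 0`: right multiplication by `t₂₀(−k₁₀∕h₂₂) · t₂₁(−k₁₁∕h₂₂)` (which fixes `f`) moves the point into `P_{(2,1)}`.
[cite: BernsteinZelevinsky1977, §5, Thm. 5.2] [cite: Casselman1995, Prop. 6.3.1] -/
theorem toFun_swap_coordOneTwo_eq_zero_of_lt {f : SmoothInd (standardParabolicGL F (id : Fin 3 → Fin 3)) σ'}
    (hf : f ∈ vanishingOn (standardParabolicGL F (id : Fin 3 → Fin 3)) σ' ((standardParabolicGL F (![0, 0, 1] : Fin 3 → Fin 2)) : Set (GL (Fin 3) F)))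
    {ε : (ValueGroupWithZero F)ˣ}
    (hα : ∀ α : F, valuation F α < ε → smoothIndRep (standardParabolicGL F (id : Fin 3 → Fin 3)) σ' (transvectionUnit 2 0 (by decide) α) f = f)
    (hβ : ∀ β : F, valuation F β < ε → smoothIndRep (standardParabolicGL F (id : Fin 3 → Fin 3)) σ' (transvectionUnit 2 1 (by decide) β) f = f)
    {k : GL (Fin 3) F} (hk : k ∈ (standardParabolicGL F (![0, 0, 1] : Fin 3 → Fin 2))) (y : F)
    (hne : (k : Matrix (Fin 3) (Fin 3) F) 1 2 + y * (k : Matrix (Fin 3) (Fin 3) F) 2 2 ≠ 0)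
    (h0 : valuation F ((k : Matrix (Fin 3) (Fin 3) F) 1 0) < (ε : ValueGroupWithZero F) * valuation F ((k : Matrix (Fin 3) (Fin 3) F) 1 2 + y * (k : Matrix (Fin 3) (Fin 3) F) 2 2))
    (h1 : valuation F ((k : Matrix (Fin 3) (Fin 3) F) 1 1) < (ε : ValueGroupWithZero F) * valuation F ((k : Matrix (Fin 3) (Fin 3) F) 1 2 + y * (k : Matrix (Fin 3) (Fin 3) F) 2 2)) :
    f.toFun ((permGL (Equiv.swap (1 : Fin 3) 2) : GL (Fin 3) F) * ((e ((0, y), 0) : ↥(unipotentRadicalGL F (id : Fin 3 → Fin 3))) : GL (Fin 3) F) * k) = 0 := by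
  haveI : IsTopologicalRing F := inferInstance
  obtain ⟨e20, e21, e22, -⟩ := swap_coordOneTwo_mul_apply e he hk y
  set h : GL (Fin 3) F := (permGL (Equiv.swap (1 : Fin 3) 2) : GL (Fin 3) F) * ((e ((0, y), 0) : ↥(unipotentRadicalGL F (id : Fin 3 → Fin 3))) : GL (Fin 3) F) * k with hh
  set d : F := (k : Matrix (Fin 3) (Fin 3) F) 1 2 + y * (k : Matrix (Fin 3) (Fin 3) F) 2 2 with hd
  have hvd : valuation F d ≠ 0 := (Valuation.ne_zero_iff _).2 hne
  -- the two small coefficients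
  have hvα : valuation F (-((k : Matrix (Fin 3) (Fin 3) F) 1 0 / d)) < ε := by
    rw [Valuation.map_neg, map_div₀]
    calc valuation F ((k : Matrix (Fin 3) (Fin 3) F) 1 0) / valuation F d < (ε : ValueGroupWithZero F) * valuation F d / valuation F d := by
          exact div_lt_div_of_pos_right h0 (zero_lt_iff.2 hvd)
      _ = ε := by rw [mul_div_assoc, div_self hvd, mul_one]
  have hvβ : valuation F (-((k : Matrix (Fin 3) (Fin 3) F) 1 1 / d)) < ε := by
    rw [Valuation.map_neg, map_div₀]
    calc valuation F ((k : Matrix (Fin 3) (Fin 3) F) 1 1) / valuation F d < (ε : ValueGroupWithZero F) * valuation F d / valuation F d := by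
          exact div_lt_div_of_pos_right h1 (zero_lt_iff.2 hvd)
      _ = ε := by rw [mul_div_assoc, div_self hvd, mul_one]
  have hfix : smoothIndRep (standardParabolicGL F (id : Fin 3 → Fin 3)) σ' (transvectionUnit 2 0 (by decide) (-((k : Matrix (Fin 3) (Fin 3) F) 1 0 / d)) * transvectionUnit 2 1 (by decide) (-((k : Matrix (Fin 3) (Fin 3) F) 1 1 / d))) f = f := by
    rw [map_mul, Module.End.mul_apply, hβ _ hvβ, hα _ hvα]
  refine toFun_eq_zero_of_mul_mem σ' hf hfix ?_
  -- the moved point lies in `P`: its entries `(2,0)`, `(2,1)` vanish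
  rw [SetLike.mem_coe, K2E3GL3MaximalParabolicRelabel.mem_standardParabolicGL_iff_entry, ← mul_assoc]
  refine ⟨?_, ?_⟩
  · rw [mul_transvectionUnit_two_one_apply, mul_transvectionUnit_two_zero_apply, mul_transvectionUnit_two_zero_apply]
    simp only [if_neg (show (0 : Fin 3) ≠ 1 by decide), if_true, add_zero]
    rw [e20, e22]
    field_simp
    ring
  · rw [mul_transvectionUnit_two_one_apply, mul_transvectionUnit_two_zero_apply, mul_transvectionUnit_two_zero_apply]
    simp only [if_neg (show (1 : Fin 3) ≠ 0 by decide), if_neg (show (2 : Fin 3) ≠ 0 by decide), if_true, add_zero]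
    rw [e21, e22]
    field_simp
    ring

/-- **UNIFORM SUPPORT OVER INTEGRAL `k`.**  If moreover `|k₁₀|, |k₁₁|, |k₁₂| ≤ 1` and `|k₂₂| = 1` (every `k ∈ P_{(2,1)} ∩ GL₃(𝒪)`), then `f(s₂ · x₁₂(y) · k) = 0` for all `y`
with `1 < |y|` and `ε⁻¹ < |y|` — the integrand `y ↦ f(s₂ x₁₂(y) k)` is supported in a ball independent of `k`. [cite: BernsteinZelevinsky1977, §5 (5.14), Thm. 5.2] -/
theorem toFun_swap_coordOneTwo_eq_zero_of_lt_valuation {f : SmoothInd (standardParabolicGL F (id : Fin 3 → Fin 3)) σ'}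
    (hf : f ∈ vanishingOn (standardParabolicGL F (id : Fin 3 → Fin 3)) σ' ((standardParabolicGL F (![0, 0, 1] : Fin 3 → Fin 2)) : Set (GL (Fin 3) F)))
    {ε : (ValueGroupWithZero F)ˣ}
    (hα : ∀ α : F, valuation F α < ε → smoothIndRep (standardParabolicGL F (id : Fin 3 → Fin 3)) σ' (transvectionUnit 2 0 (by decide) α) f = f)
    (hβ : ∀ β : F, valuation F β < ε → smoothIndRep (standardParabolicGL F (id : Fin 3 → Fin 3)) σ' (transvectionUnit 2 1 (by decide) β) f = f)
    {k : GL (Fin 3) F} (hk : k ∈ (standardParabolicGL F (![0, 0, 1] : Fin 3 → Fin 2)))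
    (hk10 : valuation F ((k : Matrix (Fin 3) (Fin 3) F) 1 0) ≤ 1) (hk11 : valuation F ((k : Matrix (Fin 3) (Fin 3) F) 1 1) ≤ 1)
    (hk12 : valuation F ((k : Matrix (Fin 3) (Fin 3) F) 1 2) ≤ 1) (hk22 : valuation F ((k : Matrix (Fin 3) (Fin 3) F) 2 2) = 1)
    {y : F} (hy1 : 1 < valuation F y) (hyε : (ε : ValueGroupWithZero F)⁻¹ < valuation F y) :
    f.toFun ((permGL (Equiv.swap (1 : Fin 3) 2) : GL (Fin 3) F) * ((e ((0, y), 0) : ↥(unipotentRadicalGL F (id : Fin 3 → Fin 3))) : GL (Fin 3) F) * k) = 0 := by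
  -- `|k₁₂ + y k₂₂| = |y|`
  have hvy : valuation F ((k : Matrix (Fin 3) (Fin 3) F) 1 2 + y * (k : Matrix (Fin 3) (Fin 3) F) 2 2) = valuation F y := by
    have hlt : valuation F ((k : Matrix (Fin 3) (Fin 3) F) 1 2) < valuation F (y * (k : Matrix (Fin 3) (Fin 3) F) 2 2) := by
      rw [map_mul, hk22, mul_one]; exact lt_of_le_of_lt hk12 hy1
    rw [Valuation.map_add_eq_of_lt_right _ hlt, map_mul, hk22, mul_one]
  have hy0 : valuation F y ≠ 0 := ne_of_gt (lt_trans zero_lt_one hy1)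
  have hne : (k : Matrix (Fin 3) (Fin 3) F) 1 2 + y * (k : Matrix (Fin 3) (Fin 3) F) 2 2 ≠ 0 := fun h => hy0 (by rw [← hvy, h, map_zero])
  have hε0 : (ε : ValueGroupWithZero F) ≠ 0 := ε.ne_zero
  have hεy : 1 < (ε : ValueGroupWithZero F) * valuation F y := by
    rwa [inv_lt_iff_one_lt_mul₀' (zero_lt_iff.2 hε0)] at hyε
  refine toFun_swap_coordOneTwo_eq_zero_of_lt σ' e he hf hα hβ hk y hne ?_ ?_
  · rw [hvy]; exact lt_of_le_of_lt hk10 hεy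
  · rw [hvy]; exact lt_of_le_of_lt hk11 hεy

/-- The integral-point form: for `k ∈ P_{(2,1)} ∩ GL₃(𝒪)` the hypotheses on the entries hold (`|kᵢⱼ| ≤ 1`, and `|k₂₂| = 1` because `det k = det(k|₂ₓ₂) · k₂₂` is a unit with both
factors integral). [cite: BernsteinZelevinsky1977, §5 (5.14)] -/
theorem toFun_swap_coordOneTwo_eq_zero_of_mem_glInt {f : SmoothInd (standardParabolicGL F (id : Fin 3 → Fin 3)) σ'}
    (hf : f ∈ vanishingOn (standardParabolicGL F (id : Fin 3 → Fin 3)) σ' ((standardParabolicGL F (![0, 0, 1] : Fin 3 → Fin 2)) : Set (GL (Fin 3) F)))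
    {ε : (ValueGroupWithZero F)ˣ}
    (hα : ∀ α : F, valuation F α < ε → smoothIndRep (standardParabolicGL F (id : Fin 3 → Fin 3)) σ' (transvectionUnit 2 0 (by decide) α) f = f)
    (hβ : ∀ β : F, valuation F β < ε → smoothIndRep (standardParabolicGL F (id : Fin 3 → Fin 3)) σ' (transvectionUnit 2 1 (by decide) β) f = f)
    {k : GL (Fin 3) F} (hk : k ∈ (standardParabolicGL F (![0, 0, 1] : Fin 3 → Fin 2))) (hkO : k ∈ glInt 3 F)
    {y : F} (hy1 : 1 < valuation F y) (hyε : (ε : ValueGroupWithZero F)⁻¹ < valuation F y) :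
    f.toFun ((permGL (Equiv.swap (1 : Fin 3) 2) : GL (Fin 3) F) * ((e ((0, y), 0) : ↥(unipotentRadicalGL F (id : Fin 3 → Fin 3))) : GL (Fin 3) F) * k) = 0 := by
  have hle := valuation_apply_le_one_of_mem_glInt hkO
  obtain ⟨h20, h21⟩ := (K2E3GL3MaximalParabolicRelabel.mem_standardParabolicGL_iff_entry k).1 hk
  -- `det k = (k₀₀ k₁₁ − k₀₁ k₁₀) · k₂₂`, all factors integral, `|det k| = 1`
  have hdet : ((Matrix.GeneralLinearGroup.det k : Fˣ) : F) = ((k : Matrix (Fin 3) (Fin 3) F) 0 0 * (k : Matrix (Fin 3) (Fin 3) F) 1 1 - (k : Matrix (Fin 3) (Fin 3) F) 0 1 * (k : Matrix (Fin 3) (Fin 3) F) 1 0) * (k : Matrix (Fin 3) (Fin 3) F) 2 2 := by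
    rw [Matrix.GeneralLinearGroup.val_det_apply, Matrix.det_fin_three, h20, h21]; ring
  have hk22 : valuation F ((k : Matrix (Fin 3) (Fin 3) F) 2 2) = 1 := by
    have h1 : valuation F (((Matrix.GeneralLinearGroup.det k : Fˣ) : F)) = 1 := valuation_det_eq_one_of_mem_glInt hkO
    rw [hdet, map_mul] at h1
    have hA : valuation F ((k : Matrix (Fin 3) (Fin 3) F) 0 0 * (k : Matrix (Fin 3) (Fin 3) F) 1 1 - (k : Matrix (Fin 3) (Fin 3) F) 0 1 * (k : Matrix (Fin 3) (Fin 3) F) 1 0) ≤ 1 := by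
      refine (Valuation.map_sub _ _ _).trans (max_le ?_ ?_)
      · rw [map_mul]; exact mul_le_one' (hle 0 0) (hle 1 1)
      · rw [map_mul]; exact mul_le_one' (hle 0 1) (hle 1 0)
    refine le_antisymm (hle 2 2) ?_
    by_contra hlt
    push Not at hlt
    have : valuation F ((k : Matrix (Fin 3) (Fin 3) F) 0 0 * (k : Matrix (Fin 3) (Fin 3) F) 1 1 - (k : Matrix (Fin 3) (Fin 3) F) 0 1 * (k : Matrix (Fin 3) (Fin 3) F) 1 0) *
        valuation F ((k : Matrix (Fin 3) (Fin 3) F) 2 2) < 1 := by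
      calc _ ≤ 1 * valuation F ((k : Matrix (Fin 3) (Fin 3) F) 2 2) := mul_le_mul_left hA _
        _ < 1 := by rw [one_mul]; exact hlt
    exact absurd h1 (ne_of_lt this)
  exact toFun_swap_coordOneTwo_eq_zero_of_lt_valuation σ' e he hf hα hβ hk (hle 1 0) (hle 1 1) (hle 1 2) hk22 hy1 hyε

end Support

end Summit.HodgeConjecture.HodgeConjecture.Cruxes.H413.K2E3GL3BorelInducedJacquetQMiddleCellSupport

end
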